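import Summits.Ventures.PercRepro.RankLevelSetCoreGeneral
import Summits.Ventures.PercRepro.RankLevelSetPlaneTen

/-!
# PercRepro — THE LARGE-CORANK CORE THEOREM AT `q = 4` FROM RANK `26` (p2, gen 14; SUBCLAIM-S1 / S1-LEAN-SPEC v3, L5′)

Night-1's `ThmN.core_all_corank_of_thresholds_of_bound` (RankLevelSetCoreGeneral) takes its three thresholds as
`max (max N₁ P₂) (2 ^ q + 2) ≤ p`, but its proof uses `N₁` only through `hN₁ n` with `n = |E|` (regime I, `n < 2p`).
Here the same proof is stated with the hypotheses split — `2 ^ q + 2 ≤ p`, `P₂ ≤ p`, `N₁ ≤ |E|` — so that at `q = 4`,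
`B = 10` (`f(4) ≤ 10`, PlaneTen) the core theorem holds from rank `p ≥ 26` (`P₂ = 26`, `2 ^ 4 + 2 = 18`) whenever
`|E| ≥ 32`, which is automatic at corank `≥ 16`: **`c025_core_four_ten'`** — every `e`-free core of rank `p ≥ 26` and
corank `> 15` satisfies C-025 at level `4` (night-1's `c025_core_four_ten` needs `p ≥ 32`).

* **`core_all_corank_of_thresholds_of_bound'`** — night-1's theorem, thresholds split (proof body verbatim);
* **`c025_core_four_ten'`** — the `q = 4` instance from rank `26`.
Axioms: standard.
-/

open scoped Matroid

namespace PercRepro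

namespace S1

open Set ThmN

variable {α : Type}

/-- **THEOREM C∞, THE CORE, WITH AN ARBITRARY FLAT BOUND — thresholds split.** Night-1's
`ThmN.core_all_corank_of_thresholds_of_bound` with `2 ^ q + 2 ≤ p`, `P₂ ≤ p` and `N₁ ≤ |E|` as separate hypotheses
(the original asks `max (max N₁ P₂) (2 ^ q + 2) ≤ p`; `N₁` enters the proof only through `n = |E| ≥ N₁`). -/
theorem core_all_corank_of_thresholds_of_bound' (q B : ℕ) (hq : 2 ≤ q) (hqB : q ≤ B) (N₁ P₂ : ℕ)
    (hN₁ : ∀ n, N₁ ≤ n → 8 * (q + 1) * 2 ^ (B - q) * n ^ q ≤ 2 ^ n)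
    (hP₂ : ∀ p, P₂ ≤ p → 2 ^ (p + q) * 2 ^ (B - q) * (2 * (p - 1 - q) + 1) ≤ 4 ^ (p - 1 - q)) :
    ∀ {α : Type} (M : Matroid α) [M.Finite] (p : ℕ), 2 ^ q + 2 ≤ p → P₂ ≤ p → N₁ ≤ M.E.ncard → M.eRank = (p : ℕ∞) →
      p + q + B + 1 < M.E.ncard →
      (∀ e ∈ M.E, ∃ A ⊆ M.E \ {e}, e ∉ M.closure A ∧ e ∉ M.closure ((M.E \ {e}) \ A)) →
      (∀ j, j ≤ q → ∀ X ⊆ M.E, M.eRk X ≤ j → X.ncard + q ≤ B + j) → RLS M p q := by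
  classical
  intro α M _ p hpP hP₂p hN₁n hR hbig hfree hBj
  set n := M.E.ncard with hn_def
  have hEcard : M.ground_finite.toFinset.card = n := by
    rw [hn_def, Set.ncard_eq_toFinset_card _ M.ground_finite]
  have hq2 : 2 * q ≤ 2 ^ q := by
    have : q ≤ 2 ^ (q - 1) := by
      calc q = (q - 1) + 1 := by omega
        _ ≤ 2 ^ (q - 1) := Nat.lt_two_pow_self
    calc 2 * q ≤ 2 * 2 ^ (q - 1) := by omega
      _ = 2 ^ (q - 1 + 1) := by ring
      _ = 2 ^ q := by congr 1; omega
  have hpn : p ≤ n := by omega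
  have hBq' : ∀ X ⊆ M.E, M.eRk X ≤ q → X.ncard ≤ B := fun X hX hr => by
    have := hBj q le_rfl X hX hr; omega
  have hU : Matroid.topCount M p q ≤ n.choose q * 2 ^ (B - q) := by
    calc Matroid.topCount M p q ≤ Matroid.levelCount M q := Matroid.topCount_le_levelCount_bot p q
      _ = {X : Set α | X ⊆ M.E ∧ M.eRk X = q}.ncard := rfl
      _ ≤ n.choose q * 2 ^ (B - q) := by rw [← hEcard]; exact ncard_eRk_eq_le_choose_mul_of_bound M q B hBq'
  have hΦ := phiK_le_two_pow_div p q
  have hU0 : (0 : ℚ) ≤ (Matroid.topCount M p q : ℚ) := by positivity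
  have hUq : (Matroid.topCount M p q : ℚ) ≤ (n.choose q : ℚ) * 2 ^ (B - q) := by exact_mod_cast hU
  rw [RLS_iff]
  rcases Nat.lt_or_ge n (2 * p) with hsmall | hlarge
  · have hd : M.E.encard = M.eRank + ((n - p : ℕ) : ℕ∞) := by
      rw [hR, ← M.ground_finite.cast_ncard_eq]
      norm_cast
      omega
    have hY := Matroid.two_pow_le_midCount_add (M := M) p q hR
    have hA := ncard_eRk_le_le_sum_choose_mul_of_bound M q B hBj
    have hB := Matroid.ncard_spanning_le (M := M) hd
    rw [hEcard] at hY hA hB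
    have hA' : (∑ j ∈ Finset.range (q + 1), n.choose j) * 2 ^ (B - q) ≤ 2 ^ (n - 3) := by
      have h1 := sum_choose_le_mul_pow n q (by omega)
      have h2 := hN₁ n (by omega)
      have h3 : 2 ^ n = 2 ^ (n - 3) * 8 := by
        rw [show (8 : ℕ) = 2 ^ 3 by norm_num, ← pow_add]; congr 1; omega
      have h5 : 8 * ((∑ j ∈ Finset.range (q + 1), n.choose j) * 2 ^ (B - q)) ≤ 8 * 2 ^ (n - 3) := by
        calc 8 * ((∑ j ∈ Finset.range (q + 1), n.choose j) * 2 ^ (B - q))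
            ≤ 8 * (((q + 1) * n ^ q) * 2 ^ (B - q)) := by gcongr
          _ = 8 * (q + 1) * 2 ^ (B - q) * n ^ q := by ring
          _ ≤ 2 ^ n := h2
          _ = 8 * 2 ^ (n - 3) := by rw [h3]; ring
      exact Nat.le_of_mul_le_mul_left h5 (by norm_num)
    have hB' : ∑ j ∈ Finset.range (n - p + 1), n.choose j ≤ 2 ^ (n - 1) :=
      sum_choose_le_two_pow_pred n (n - p) (by omega)
    have hCn : n.choose q ≤ 2 ^ q * (p + q).choose p := by
      rw [Nat.choose_symm_add]
      exact choose_le_two_pow_mul_choose n p q (by omega)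
    have hYq : (2 : ℚ) ^ n ≤ (Matroid.midCount M p q : ℚ) + ({X : Set α | X ⊆ M.E ∧ M.eRk X ≤ q}.ncard : ℚ) +
        ({X : Set α | X ⊆ M.E ∧ M.eRk X = M.eRank}.ncard : ℚ) := by exact_mod_cast hY
    have hAq : ({X : Set α | X ⊆ M.E ∧ M.eRk X ≤ q}.ncard : ℚ) ≤ 2 ^ (n - 3) := by
      exact_mod_cast hA.trans hA'
    have hBq2 : ({X : Set α | X ⊆ M.E ∧ M.eRk X = M.eRank}.ncard : ℚ) ≤ 2 ^ (n - 1) := by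
      exact_mod_cast hB.trans hB'
    have hCnq : (n.choose q : ℚ) ≤ 2 ^ q * ((p + q).choose p : ℚ) := by exact_mod_cast hCn
    have hk : p + 2 * q + (B - q) + 2 ≤ n := by omega
    exact coreSharper_arith_I hq hk hΦ hU0 hUq hCnq hYq hAq hBq2
  · have hY := choose_le_midCount_of_two_pow_le M hfree (p := p) (q := q) (by omega) (by omega)
    rw [hEcard] at hY
    have hkey := choose_mul_le_choose_mul_of_threshold n p q (2 ^ (B - q)) (by omega) hlarge (hP₂ p hP₂p)
    have hYq : (n.choose (p - 1) : ℚ) ≤ (Matroid.midCount M p q : ℚ) := by exact_mod_cast hY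
    have hUq' : (Matroid.topCount M p q : ℚ) ≤ (n.choose q : ℚ) * ((2 ^ (B - q) : ℕ) : ℚ) := by
      exact_mod_cast hU
    exact coreSharp_arith_II hΦ hU0 hUq' hkey hYq

/-- **The `q = 4` core threshold from rank `26`**: every `e`-free core of rank `p ≥ 26` and corank `> 15` satisfies
C-025 at level `4` — `core_all_corank_of_thresholds_of_bound'` with `B = 10` (`f(4) ≤ 10`), `N₁ = 32 ≤ p + 16 ≤ |E|`,
`P₂ = 26`, `2 ^ 4 + 2 = 18 ≤ p`. -/
theorem c025_core_four_ten' (M : Matroid α) [M.Finite] (p : ℕ) (hp : 26 ≤ p) (hR : M.eRank = (p : ℕ∞))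
    (hbig : p + 15 < M.E.ncard)
    (hfree : ∀ e ∈ M.E, ∃ A ⊆ M.E \ {e}, e ∉ M.closure A ∧ e ∉ M.closure ((M.E \ {e}) \ A)) : RLS M p 4 := by
  have hN₁ : ∀ n, 32 ≤ n → 8 * (4 + 1) * 2 ^ (10 - 4) * n ^ 4 ≤ 2 ^ n :=
    mul_pow_le_two_pow_of_base (8 * (4 + 1) * 2 ^ (10 - 4)) 4 32 (by norm_num) (by norm_num) (by norm_num)
  have hP₂ := threshold_II_of_base 4 (2 ^ (10 - 4)) 26 (by norm_num) (by norm_num)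
  have hBj : ∀ j : ℕ, j ≤ 4 → ∀ X ⊆ M.E, M.eRk X ≤ j → X.ncard + 4 ≤ 10 + j := by
    intro j hj X hX hr
    rcases Nat.lt_or_ge j 4 with h | h
    · have := ncard_add_one_le_two_pow_of_eRk_le M (not_isLoop_of_free M hfree) hfree j X hX hr
      interval_cases j <;> omega
    · have hj4 : j = 4 := by omega
      subst hj4
      have := ncard_le_ten_of_eRk_le_four_of_free M hfree hX hr
      omega
  exact core_all_corank_of_thresholds_of_bound' 4 10 (by norm_num) (by norm_num) 32 26 hN₁ hP₂ M p
    (by norm_num; omega) hp (by omega) hR (by omega) hfree hBj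

end S1

end PercRepro
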